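import Literature.MathematicalPhysics.QuantumFieldTheory.Balaban1983to89.B4Lower18

/-!
# NE7K1LinBlockCoords — row NE7 (node U5), candidate route HOM, path H1L, cell K1-lin(s), U = 1 instance, piece 2: the
# BLOCK COORDINATES (one-step block MEANS ⊕ in-block FLUCTUATIONS) on a union `R′` of `L`-blocks — the coordinate matrix
# `T`, its weight compatibility, and the exact block identity `Σ_{x′∈b}(Tu)(x′)² = L^{d+1}V_b² + S_b² + Σ_jψ_{b,j}²`, whence
# `‖u‖² ≤ ‖Tu‖² ≤ (L^{d+1}+1)‖u‖²`

Lineage `b2b-balaban-t4-ne7-p2` (CRUX PROVER NE7 #2), generation 63.  Context: `Support/NE7K1LinSchurLineCoords` (p285751) reduces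
the `H₁ = c·TᵀMT` hypotheses of `NE7K1LinSchurLineForm.lineOpR_inv_decay_form` to facts about `M` plus (i) weight
compatibility of `T` and (ii) two-sided bounds `c_T‖u‖² ≤ ‖Tu‖² ≤ C_T‖u‖²`.  THIS FILE builds the concrete `T` of the
two-cutoff instance: run B's fine field `φ′` on `R′` (a union of `L`-blocks, `L` = the refinement factor between the two
runs' lattices) is written as `φ′ = T(V, ψ)` with `V_b` = the value carried by the block `b` (coarse index
`b ∈ R′.image (blk L)` = run A's site) and `ψ_{b,j}`, `j ≠ 0`, the in-block fluctuations at the non-anchor offsets: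
`φ′(Lb + j) = V_b + ψ_{b,j}` (`j ≠ 0`), `φ′(Lb) = V_b − Σ_{j≠0}ψ_{b,j}` — so that `V_b` IS the block MEAN of `φ′`
(Bałaban's one-step average `Q₁` at `A = 0`) and `ψ` parametrises `ker Q₁` block-locally.  PROVED ([folklore], over the
tree's block charts `B4Lower18.rblk ∕ rchart`):
* `coordT` (the matrix), `coordT_compat` (an entry `T x′ c ≠ 0` forces `rblk L R′ x′ = site c` — the weight-compatibility
  premise of `NE7K1LinSchurLineCoords.conjError_congr` for block-constant weights);
* `coordT_mulVec_rchart` (the two displayed formulas);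
* `sum_sq_block` — `Σ_j (Tu)(rchart b j)² = L^{d+1}·V_b² + (Σ_jψ_{b,j})² + Σ_jψ_{b,j}²` (the cross terms cancel EXACTLY);
* `dot_le_coordT` (`‖u‖² ≤ ‖Tu‖²`, so `c_T = 1`) and `coordT_le_dot` (`‖Tu‖² ≤ (L^{d+1}+1)‖u‖²`).
0 Bałaban letters beyond the tree's charts; nothing printed asserted; no `sorry`.  HONEST FRAMING: FIXED FINITE T⁴, rung (B)+1;
NE7 NOT PRINTED ∕ NOT PROVED; spine 0∕9; NOT infinite volume, NOT mass gap, NOT Clay.  HONEST DEPENDENCY: continuum YM on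
T⁴ ⇐ BetaPertH ∧ nine spine estimates (0/9 proved); BetaPertH ⇐ (D1) ∧ (D4) ∧ CAP+tail; G-an2-4 gates asym, D1 and NE2/3/4.
-/

noncomputable section

open Finset Matrix

namespace Summit.QuantumFields.BalabanUV.T4Continuum.NE7K1LinBlockCoords

open Literature.MathematicalPhysics.QuantumFieldTheory.Balaban1983to89
open Literature.MathematicalPhysics.QuantumFieldTheory.Balaban1983to89.B4Reflection242 (blk)
open Literature.MathematicalPhysics.QuantumFieldTheory.Balaban1983to89.B4Lower18

variable {d : ℕ}

/-- the NON-ZERO offsets `j ∈ {0,…,L−1}^{d+1} ∖ {0}` inside an `L`-block (the in-block fluctuation labels). [folklore] -/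
abbrev NZ (d L : ℕ) [NeZero L] : Type := {j : Fin (d + 1) → Fin L // j ≠ 0}

section Coords

variable {L : ℕ} [NeZero L] {R' : Finset (Fin (d + 1) → ℤ)} (hR : IsBlockUnion L R')

/-- the coarse site carried by a coordinate label. [folklore] -/
def site : ↥(R'.image (blk L)) ⊕ (↥(R'.image (blk L)) × NZ d L) → ↥(R'.image (blk L))
  | Sum.inl b => b
  | Sum.inr bj => bj.1

/-- **THE COORDINATE MATRIX `T`**: `φ′ = T(V, ψ)` with `φ′(Lb + j) = V_b + ψ_{b,j}` (`j ≠ 0`) and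
`φ′(Lb) = V_b − Σ_{j≠0}ψ_{b,j}`. [folklore] -/
def coordT : Matrix ↥R' (↥(R'.image (blk L)) ⊕ (↥(R'.image (blk L)) × NZ d L)) ℝ :=
  Matrix.of fun x' c => match c with
    | Sum.inl b => if rblk L R' x' = b then 1 else 0
    | Sum.inr bj => (if x' = rchart NeZero.one_le hR bj.1 bj.2.1 then 1 else 0) -
        (if x' = rchart NeZero.one_le hR bj.1 0 then 1 else 0)

/-- charts are jointly injective: `rchart b j = rchart b′ j′ → b = b′ ∧ j = j′`. [folklore] -/
theorem rchart_inj2 {b b' : ↥(R'.image (blk L))} {j j' : Fin (d + 1) → Fin L}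
    (h : rchart NeZero.one_le hR b j = rchart NeZero.one_le hR b' j') : b = b' ∧ j = j' := by
  have hb : b = b' := by
    have := congrArg (rblk L R') h
    rwa [rblk_rchart, rblk_rchart] at this
  subst hb
  exact ⟨rfl, rchart_injective NeZero.one_le hR b h⟩

/-- **WEIGHT COMPATIBILITY of `T`**: a nonzero entry `T x′ c` forces `x′` to lie in the block of `site c`. [folklore] -/
theorem coordT_compat (x' : ↥R') (c : ↥(R'.image (blk L)) ⊕ (↥(R'.image (blk L)) × NZ d L))
    (h : coordT hR x' c ≠ 0) : rblk L R' x' = site c := by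
  rcases c with b | ⟨b, j⟩
  · simp only [coordT, Matrix.of_apply, site] at h ⊢
    by_contra hne
    exact h (if_neg hne)
  · simp only [coordT, Matrix.of_apply, site] at h ⊢
    by_cases h1 : x' = rchart NeZero.one_le hR b j.1
    · rw [h1, rblk_rchart]
    · by_cases h2 : x' = rchart NeZero.one_le hR b 0
      · rw [h2, rblk_rchart]
      · exact absurd (by rw [if_neg h1, if_neg h2, sub_zero]) h

/-- **`T` ON A CHART POINT**: `(Tu)(rchart b j) = u_b + ψ_{b,j}` for `j ≠ 0` and `= u_b − Σ_{j′≠0}ψ_{b,j′}` for `j = 0`.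
[folklore] -/
theorem coordT_mulVec_rchart (u : ↥(R'.image (blk L)) ⊕ (↥(R'.image (blk L)) × NZ d L) → ℝ)
    (b : ↥(R'.image (blk L))) (j : Fin (d + 1) → Fin L) :
    (coordT hR).mulVec u (rchart NeZero.one_le hR b j) =
      u (Sum.inl b) + (if h : j ≠ 0 then u (Sum.inr (b, ⟨j, h⟩)) else -∑ j' : NZ d L, u (Sum.inr (b, j'))) := by
  classical
  simp only [mulVec, dotProduct, Fintype.sum_sum_type, coordT, Matrix.of_apply]
  congr 1
  · -- coarse part
    simp only [rblk_rchart, ite_mul, one_mul, zero_mul]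
    rw [Finset.sum_ite_eq]
    simp
  · -- fluctuation part
    rw [Fintype.sum_prod_type]
    have hother : ∀ b' : ↥(R'.image (blk L)), b' ≠ b →
        ∑ j' : NZ d L, ((if rchart NeZero.one_le hR b j = rchart NeZero.one_le hR b' j'.1 then (1 : ℝ) else 0) -
          (if rchart NeZero.one_le hR b j = rchart NeZero.one_le hR b' 0 then (1 : ℝ) else 0)) * u (Sum.inr (b', j')) = 0 := by
      intro b' hb'
      refine Finset.sum_eq_zero fun j' _ => ?_
      rw [if_neg (fun h => hb' (rchart_inj2 hR h).1.symm), if_neg (fun h => hb' (rchart_inj2 hR h).1.symm),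
        sub_zero, zero_mul]
    rw [Fintype.sum_eq_single b (fun b' hb' => hother b' hb')]
    by_cases hj : j = 0
    · subst hj
      simp only [ne_eq, not_true_eq_false, dite_false]
      rw [← Finset.sum_neg_distrib]
      refine Finset.sum_congr rfl fun j' _ => ?_
      rw [if_neg (fun h => j'.2 ((rchart_inj2 hR h).2).symm)]
      simp
    · simp only [ne_eq, hj, not_false_eq_true, dite_true]
      rw [Finset.sum_eq_single (⟨j, hj⟩ : NZ d L)]
      · rw [if_pos rfl, if_neg (fun h => hj (rchart_inj2 hR h).2)]
        ring
      · intro j' _ hj'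
        rw [if_neg (fun h => hj' (Subtype.ext ((rchart_inj2 hR h).2).symm)), if_neg (fun h => hj (rchart_inj2 hR h).2),
          sub_zero, zero_mul]
      · intro h; exact absurd (Finset.mem_univ _) h

/-- sums over `R′` reorganised by blocks and charts: `Σ_{x′} F x′ = Σ_b Σ_j F(rchart b j)`. [folklore] -/
theorem sum_eq_sum_blocks (F : ↥R' → ℝ) :
    ∑ x', F x' = ∑ b : ↥(R'.image (blk L)), ∑ j : Fin (d + 1) → Fin L, F (rchart NeZero.one_le hR b j) := by
  classical
  rw [← Finset.sum_fiberwise_of_maps_to (s := Finset.univ) (t := Finset.univ) (g := rblk L R')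
    (fun x _ => Finset.mem_univ _) F]
  refine Finset.sum_congr rfl fun b _ => ?_
  rw [filter_rblk_eq_image NeZero.one_le hR b, Finset.sum_image fun j _ j' _ h => rchart_injective NeZero.one_le hR b h]

/-- sums over all offsets split into the anchor `0` and the non-zero offsets. [folklore] -/
theorem sum_offsets_split (f : (Fin (d + 1) → Fin L) → ℝ) :
    ∑ j, f j = f 0 + ∑ j' : NZ d L, f j'.1 := by
  classical
  rw [← Finset.sum_erase_add _ _ (Finset.mem_univ (0 : Fin (d + 1) → Fin L)), add_comm]
  congr 1
  rw [← Finset.sum_subtype (Finset.univ.erase (0 : Fin (d + 1) → Fin L)) (p := fun j => j ≠ 0)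
    (fun j => by simp [Finset.mem_erase])]

/-- **THE BLOCK IDENTITY**: `Σ_j (Tu)(rchart b j)² = L^{d+1}·V_b² + (Σ_{j≠0}ψ_{b,j})² + Σ_{j≠0}ψ_{b,j}²` — the cross terms
`±2V_bΣψ` cancel exactly. [folklore] -/
theorem sum_sq_block (u : ↥(R'.image (blk L)) ⊕ (↥(R'.image (blk L)) × NZ d L) → ℝ) (b : ↥(R'.image (blk L))) :
    ∑ j : Fin (d + 1) → Fin L, ((coordT hR).mulVec u (rchart NeZero.one_le hR b j)) ^ 2 =
      (L : ℝ) ^ (d + 1) * u (Sum.inl b) ^ 2 + (∑ j' : NZ d L, u (Sum.inr (b, j'))) ^ 2 +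
        ∑ j' : NZ d L, u (Sum.inr (b, j')) ^ 2 := by
  classical
  set V := u (Sum.inl b) with hV
  set S := ∑ j' : NZ d L, u (Sum.inr (b, j')) with hS
  -- the fluctuation profile over ALL offsets: `g 0 = −S`, `g j = ψ_j`
  set g : (Fin (d + 1) → Fin L) → ℝ := fun j =>
    if h : j ≠ 0 then u (Sum.inr (b, ⟨j, h⟩)) else -S with hg
  have hTg : ∀ j, (coordT hR).mulVec u (rchart NeZero.one_le hR b j) = V + g j := fun j => by
    rw [coordT_mulVec_rchart]
  simp_rw [hTg]
  have hsum_g : ∑ j, g j = 0 := by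
    rw [sum_offsets_split]
    simp only [hg, ne_eq, not_true_eq_false, dite_false]
    have : ∀ j' : NZ d L, (if h : ¬ (j'.1 = 0) then u (Sum.inr (b, ⟨j'.1, h⟩)) else -S) = u (Sum.inr (b, j')) :=
      fun j' => by rw [dif_pos j'.2]
    simp_rw [this]
    rw [hS]; ring
  have hsum_g2 : ∑ j, g j ^ 2 = S ^ 2 + ∑ j' : NZ d L, u (Sum.inr (b, j')) ^ 2 := by
    rw [sum_offsets_split]
    simp only [hg, ne_eq, not_true_eq_false, dite_false, neg_sq]
    congr 1
    refine Finset.sum_congr rfl fun j' _ => ?_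
    rw [dif_pos j'.2]
  have hcard : (Finset.univ : Finset (Fin (d + 1) → Fin L)).card = L ^ (d + 1) := by
    rw [Finset.card_univ, Fintype.card_fun, Fintype.card_fin, Fintype.card_fin]
  calc ∑ j, (V + g j) ^ 2 = ∑ j, (V ^ 2 + 2 * V * g j + g j ^ 2) := Finset.sum_congr rfl fun j _ => by ring
    _ = (Finset.univ : Finset (Fin (d + 1) → Fin L)).card * V ^ 2 + 2 * V * ∑ j, g j + ∑ j, g j ^ 2 := by
        rw [Finset.sum_add_distrib, Finset.sum_add_distrib, Finset.sum_const, nsmul_eq_mul, Finset.mul_sum]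
    _ = (L : ℝ) ^ (d + 1) * V ^ 2 + S ^ 2 + ∑ j' : NZ d L, u (Sum.inr (b, j')) ^ 2 := by
        rw [hsum_g, hsum_g2, hcard]; push_cast; ring

/-- `‖u‖²` in block coordinates: `Σ_b (V_b² + Σ_jψ_{b,j}²)`. [folklore] -/
theorem dot_self_coords (u : ↥(R'.image (blk L)) ⊕ (↥(R'.image (blk L)) × NZ d L) → ℝ) :
    u ⬝ᵥ u = ∑ b : ↥(R'.image (blk L)), (u (Sum.inl b) ^ 2 + ∑ j' : NZ d L, u (Sum.inr (b, j')) ^ 2) := by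
  simp only [dotProduct, Fintype.sum_sum_type, Fintype.sum_prod_type, Finset.sum_add_distrib, sq]

/-- `‖Tu‖²` in block coordinates. [folklore] -/
theorem coordT_dot_self (u : ↥(R'.image (blk L)) ⊕ (↥(R'.image (blk L)) × NZ d L) → ℝ) :
    (coordT hR).mulVec u ⬝ᵥ (coordT hR).mulVec u = ∑ b : ↥(R'.image (blk L)),
      ((L : ℝ) ^ (d + 1) * u (Sum.inl b) ^ 2 + (∑ j' : NZ d L, u (Sum.inr (b, j'))) ^ 2 +
        ∑ j' : NZ d L, u (Sum.inr (b, j')) ^ 2) := by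
  have h : (coordT hR).mulVec u ⬝ᵥ (coordT hR).mulVec u = ∑ x', ((coordT hR).mulVec u x') ^ 2 := by
    simp only [dotProduct, sq]
  rw [h, sum_eq_sum_blocks hR]
  exact Finset.sum_congr rfl fun b _ => sum_sq_block hR u b

/-- **LOWER BOUND `c_T = 1`**: `‖u‖² ≤ ‖Tu‖²`. [folklore] -/
theorem dot_le_coordT (u : ↥(R'.image (blk L)) ⊕ (↥(R'.image (blk L)) × NZ d L) → ℝ) :
    1 * (u ⬝ᵥ u) ≤ (coordT hR).mulVec u ⬝ᵥ (coordT hR).mulVec u := by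
  rw [one_mul, dot_self_coords, coordT_dot_self]
  refine Finset.sum_le_sum fun b _ => ?_
  have hL1 : (1 : ℝ) ≤ (L : ℝ) ^ (d + 1) := one_le_pow₀ (by exact_mod_cast (NeZero.one_le : 1 ≤ L))
  nlinarith [sq_nonneg (u (Sum.inl b)), sq_nonneg (∑ j' : NZ d L, u (Sum.inr (b, j')))]

/-- **UPPER BOUND `C_T = L^{d+1} + 1`**: `‖Tu‖² ≤ (L^{d+1}+1)‖u‖²` (`S_b² ≤ |NZ|·Σψ² ≤ L^{d+1}Σψ²`). [folklore] -/
theorem coordT_le_dot (u : ↥(R'.image (blk L)) ⊕ (↥(R'.image (blk L)) × NZ d L) → ℝ) :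
    (coordT hR).mulVec u ⬝ᵥ (coordT hR).mulVec u ≤ ((L : ℝ) ^ (d + 1) + 1) * (u ⬝ᵥ u) := by
  classical
  rw [dot_self_coords, coordT_dot_self, Finset.mul_sum]
  refine Finset.sum_le_sum fun b _ => ?_
  have hcardNZ : (Fintype.card (NZ d L) : ℝ) ≤ (L : ℝ) ^ (d + 1) := by
    have h1 : Fintype.card (NZ d L) ≤ Fintype.card (Fin (d + 1) → Fin L) := Fintype.card_subtype_le _
    rw [Fintype.card_fun, Fintype.card_fin, Fintype.card_fin] at h1
    exact_mod_cast h1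
  have hCS : (∑ j' : NZ d L, u (Sum.inr (b, j'))) ^ 2 ≤
      (Fintype.card (NZ d L) : ℝ) * ∑ j' : NZ d L, u (Sum.inr (b, j')) ^ 2 := by
    have := sq_sum_le_card_mul_sum_sq (s := (Finset.univ : Finset (NZ d L))) (f := fun j' => u (Sum.inr (b, j')))
    simpa [Finset.card_univ] using this
  have hψ0 : 0 ≤ ∑ j' : NZ d L, u (Sum.inr (b, j')) ^ 2 := Finset.sum_nonneg fun _ _ => sq_nonneg _
  have hL0 : (0 : ℝ) ≤ (L : ℝ) ^ (d + 1) := by positivity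
  nlinarith [sq_nonneg (u (Sum.inl b)), mul_le_mul_of_nonneg_right hcardNZ hψ0]

end Coords

end Summit.QuantumFields.BalabanUV.T4Continuum.NE7K1LinBlockCoords
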